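import Literature.MathematicalPhysics.QuantumFieldTheory.Balaban1983to89.T4ApexTwoLevel
import Literature.MathematicalPhysics.QuantumFieldTheory.Balaban1983to89.T4MatchingAssembly

/-!
# `Balaban1983to89.T4ApexHybrid` — the apex fed by node U5's PER-STRING output shape: per-string hybrid-NE7 data under
the targets' quantifier prefix ⇒ the four T4 targets; per-string Cauchy radii suffice and lose nothing
(cell `pub-balaban`, lineage `b2b-balaban-t4-lean`, v1)

HONEST FRAMING (cell `pub-balaban`, T4-DAG PAGE 1).  The cell's T4 target is rung (B)+1 for pure Yang–Mills on a FINITE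
four-torus of FIXED physical size: existence AND uniqueness (full-sequence convergence, no subsequences) of the
`ε = L^{-K} → 0` limit of the joint expectations of unit-scale averaged loop variables, plus reflection positivity on the
time-zero two-block-local cone and hypercubic covariance of the limit functional.  In the words of the problem
description — A. Jaffe, E. Witten, *Quantum Yang–Mills theory* (Clay problem description) §6.5 p. 11: "One must then
verify the existence of limits of appropriate expectations of gauge-invariant observables as the lattice spacing tends to
zero and as the volume tends to infinity." — this package concerns the FIRST of these two limits ONLY, on ONE torus; it is
NOT infinite volume, NOT a mass gap, NOT the Clay problem, and the statement it organises is asserted by no accepted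
mathematical result for `d = 4`.  NOTHING of T. Bałaban's renormalization-group analysis is asserted here: every estimate
of the cell's DAG (nodes U1–U5, NE1–NE7) stays a HYPOTHESIS SHAPE (a `Prop`-valued predicate), never a fact; no step of a
manuscript under audit is used; no internally-minted statement is cited.  This module is PURELY LOGICAL bookkeeping over
modules already in the tree.  Value = a kernel certificate of the end-to-end plumbing BY NAME; NOT summit progress.

WHAT IS PROVED (all `[folklore]`, i.e. elementary logic over the tree's declarations).
* §1 (scheme level, any `Missing.TorusScheme` with `β_K ≥ 0` and measurable observables bounded by `1`).
  `StringwiseGenFunCauchy S` := every string `os` has ITS OWN radius `l₀(os) > 0` on which the generating functions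
  `K ↦ genFun (schemeZ S os) K t`, `|t| ≤ l₀(os)`, are Cauchy — node U6's output with a PER-STRING radius instead of the
  uniform radius of `T4Assembly.GenFunCauchy S l₀`.  It implies `Missing.HasContinuumLimit S` (the tree's per-string node
  U0, `T4Assembly.tendsto_expectAt_of_cauchySeq_genFun`), and — by the tree's converse `T4GenFunConverse` — it is
  EQUIVALENT to it and to the uniform shape at every radius: `stringwise_iff_hasContinuumLimit`,
  `stringwise_iff_genFunCauchy`.  So NO UNIFORMITY IN THE STRING is required of the new estimates, and none is lost.
  `StringwiseHybridNE7 S` := every string carries a hybrid-NE7 datum `T4MatchingAssembly.StringHybridNE7 S os l₀ vol K₀`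
  with its own `l₀(os) > 0`, `vol(os) > 0`, `K₀(os)` (node U5's per-string output shape as typed by the `pv02` lineage;
  the conclusions of `T4MatchingClosure.stringHybridNE7_closure` / `T4MatchingClosureRem.stringHybridNE7_closure_remnantW`
  land in it literally, `stringwiseHybridNE7_of_offset`).  It implies `StringwiseGenFunCauchy S`
  (`T4MatchingAssembly.matchingModConstants_schemeZ` + `T4CauchySum.cauchySeq_genFun`), hence `HasContinuumLimit S`.
* §2 (under the prefix, any `T4Continuum.FiniteEpsData`).  `StringwiseUnder D Hβ`, `HybridNE7Under D Hβ` := the two shapes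
  under `FiniteEpsData.UnderHypotheses Hβ` along the data's Wilson schemes `D.scheme g₀`; monotonicity
  `HybridNE7Under → StringwiseUnder ← GenFunCauchyUnder`; for data with measurable averaging maps
  `StringwiseUnder D (BetaPertHyp D.βfun) ↔ D.ym4_torus_continuum_limit_exists` (and the print-faithful primed form), and
  `HybridNE7Under D (BetaPertHyp D.βfun) → D.ym4_torus_continuum_limit_exists`.
* §3 (the apex, `SU(N)`).  For (0.4)-data (`IsBlockAveraged`, and the two-level `IsBlockAveraged₂`) with measurable
  small-field averages: `HybridNE7Under D (BetaPertHyp D.βfun)` ⇒ ALL FOUR TARGETS (`targets_of_hybridNE7Under`,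
  `targets₂_of_hybridNE7Under`, primed forms), the four targets ⇔ `StringwiseUnder` (`targets_iff_stringwiseUnder`), and the
  restricted headline `T4Apex.YM4TorusContinuumBlockSU N` from per-string hybrid-NE7 data for all (0.4)-data
  (`blockSU_of_hybridNE7Under`).
So, BY NAME and kernel-checked: what is OPEN in rung (B)+1 for Bałaban-averaged `SU(N)` data is AT MOST the per-string
hybrid-NE7 data under the prefix (the cell's located new estimates NE1–NE7 / U1–U5, none in print, as organised by
`T4MatchingAssembly`), and EXACTLY the per-string Cauchy shape `StringwiseUnder`.

NOT PROVED, NOT CLAIMED: any hybrid-NE7 datum for any Bałaban scheme; (B) = [Balaban1989LargeFieldII] Thm 1 (a pinned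
hypothesis inside the prefix); the β-side hypothesis; anything about infinite volume or a mass gap.
ONE-WRITER: this file belongs to the `b2b-balaban-t4-lean` lineage (owner of `T4Continuum`, `T4Apex`, `T4ApexTwoLevel`);
it is a LEAF (imports `T4ApexTwoLevel`, `T4MatchingAssembly`; imported by nothing) and touches no other module.
Cell records: `t4/LEAN-TYPING.md` §4c, DIVERGENCE D-t4l.15 (per-string radius), GAPS C-t4l-21.
-/

namespace Literature.MathematicalPhysics.QuantumFieldTheory.Balaban1983to89

open _root_.Filter _root_.Topology
open Missing T4Continuum

namespace T4ApexHybrid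

/-! ## §1 Scheme level: per-string Cauchy radii, per-string hybrid-NE7 data -/

section Scheme

variable {G : Type*} [GaugeGroup G] [MeasurableSpace G] [RegularGaugeGroup G] [HaarData G] {O : Type*}

/-- NODE U6's OUTPUT WITH A PER-STRING RADIUS: every string `os` has some `l₀(os) > 0` such that for `|t| ≤ l₀(os)` the
generating functions `K ↦ genFun (schemeZ S os) K t` are Cauchy.  HYPOTHESIS SHAPE. [folklore] -/
def StringwiseGenFunCauchy (S : TorusScheme G O) : Prop :=
  ∀ os : List O, ∃ l₀ : ℝ, 0 < l₀ ∧ ∀ t : ℝ, |t| ≤ l₀ →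
    CauchySeq fun K => T4CauchySum.genFun (T4GenFunBounds.schemeZ S os) K t

/-- NODE U5's PER-STRING OUTPUT SHAPE: every string carries a hybrid-NE7 datum (`T4MatchingAssembly.StringHybridNE7`) with
its own radius `l₀(os) > 0`, volume factor `vol(os) > 0` and offset `K₀(os)`.  HYPOTHESIS SHAPE — the cell's located new
estimates, none in print. [folklore] -/
def StringwiseHybridNE7 (S : TorusScheme G O) : Prop :=
  ∀ os : List O, ∃ (l₀ vol : ℝ) (K₀ : ℕ), 0 < l₀ ∧ 0 < vol ∧ T4MatchingAssembly.StringHybridNE7 S os l₀ vol K₀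

omit [RegularGaugeGroup G] in
/-- Uniform radius ⇒ per-string radius. [folklore] -/
theorem stringwise_of_genFunCauchy (S : TorusScheme G O) {l₀ : ℝ} (hl₀ : 0 < l₀) (h : T4Assembly.GenFunCauchy S l₀) :
    StringwiseGenFunCauchy S :=
  fun os => ⟨l₀, hl₀, fun t ht => h os t ht⟩

omit [RegularGaugeGroup G] in
/-- Uniform per-string hybrid-NE7 data (the hypothesis of `T4MatchingAssembly.genFunCauchy_of_hybridNE7`, `0 < l₀`) ⇒
the per-string shape. [folklore] -/
theorem stringwiseHybridNE7_of_uniform (S : TorusScheme G O) {l₀ : ℝ} (hl₀ : 0 < l₀)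
    (h : ∀ os : List O, ∃ (vol : ℝ) (K₀ : ℕ), 0 < vol ∧ T4MatchingAssembly.StringHybridNE7 S os l₀ vol K₀) :
    StringwiseHybridNE7 S := fun os => by
  obtain ⟨vol, K₀, hvol, hH⟩ := h os
  exact ⟨l₀, vol, K₀, hl₀, hvol, hH⟩

omit [RegularGaugeGroup G] in
/-- The closure theorems' output shape (`… ∃ K₁, StringHybridNE7 S os l₀ vol (K₀ + K₁)`, as in
`T4MatchingClosure.stringHybridNE7_closure` / `T4MatchingClosureRem.stringHybridNE7_closure_remnantW`) lands in the
per-string shape literally. [folklore] -/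
theorem stringwiseHybridNE7_of_offset (S : TorusScheme G O)
    (h : ∀ os : List O, ∃ (l₀ vol : ℝ) (K₀ : ℕ), 0 < l₀ ∧ 0 < vol ∧
      ∃ K₁ : ℕ, T4MatchingAssembly.StringHybridNE7 S os l₀ vol (K₀ + K₁)) :
    StringwiseHybridNE7 S := fun os => by
  obtain ⟨l₀, vol, K₀, hl₀, hvol, K₁, hH⟩ := h os
  exact ⟨l₀, vol, K₀ + K₁, hl₀, hvol, hH⟩

/-- **PER-STRING HYBRID-NE7 DATA ⇒ PER-STRING CAUCHY RADII**, for a scheme with `β_K ≥ 0` and measurable observables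
bounded by `1`: per string, `T4MatchingAssembly.matchingModConstants_schemeZ` (node U5's output, positivity discharged,
head free) then `T4CauchySum.cauchySeq_genFun`. [folklore] -/
theorem stringwise_of_stringwiseHybridNE7 (S : TorusScheme G O) (hβ : ∀ K, 0 ≤ S.β K)
    (hm : ∀ K o, Measurable (S.obs K o)) (h1 : ∀ K o U, |S.obs K o U| ≤ 1) (h : StringwiseHybridNE7 S) :
    StringwiseGenFunCauchy S := fun os => by
  obtain ⟨l₀, vol, K₀, hl₀, hvol, hH⟩ := h os
  obtain ⟨δ, hδ, hU5⟩ := T4MatchingAssembly.matchingModConstants_schemeZ S hβ hm h1 hl₀.le hvol os hH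
  exact ⟨l₀, hl₀, fun t ht => T4CauchySum.cauchySeq_genFun hU5 hl₀.le hδ ht⟩

/-- **PER-STRING CAUCHY RADII ⇒ THE CONTINUUM LIMIT EXISTS along the full sequence** (`Missing.HasContinuumLimit`): the
tree's per-string node U0 `T4Assembly.tendsto_expectAt_of_cauchySeq_genFun`, string by string, each at its own radius.
No uniformity of the radius in the string is needed. [folklore] -/
theorem hasContinuumLimit_of_stringwise (S : TorusScheme G O) (hβ : ∀ K, 0 ≤ S.β K)
    (hm : ∀ K o, Measurable (S.obs K o)) (h1 : ∀ K o U, |S.obs K o U| ≤ 1) (h : StringwiseGenFunCauchy S) :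
    HasContinuumLimit S := fun os => by
  obtain ⟨l₀, hl₀, hc⟩ := h os
  exact T4Assembly.tendsto_expectAt_of_cauchySeq_genFun S hβ hm h1 os hl₀ fun t ht0 htr =>
    hc t ((abs_of_pos ht0).le.trans htr.le)

/-- **PER-STRING RADII LOSE NOTHING**: `StringwiseGenFunCauchy S ↔ Missing.HasContinuumLimit S` (⇐ by the tree's
converse `T4GenFunConverse.genFunCauchy_of_hasContinuumLimit`, at radius `1`). [folklore] -/
theorem stringwise_iff_hasContinuumLimit (S : TorusScheme G O) (hβ : ∀ K, 0 ≤ S.β K)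
    (hm : ∀ K o, Measurable (S.obs K o)) (h1 : ∀ K o U, |S.obs K o U| ≤ 1) :
    StringwiseGenFunCauchy S ↔ HasContinuumLimit S :=
  ⟨hasContinuumLimit_of_stringwise S hβ hm h1, fun h =>
    stringwise_of_genFunCauchy S one_pos (T4GenFunConverse.genFunCauchy_of_hasContinuumLimit S hβ hm h1 h 1)⟩

/-- … and `StringwiseGenFunCauchy S ↔ T4Assembly.GenFunCauchy S l₀` for EVERY `0 < l₀`: per-string radius ⇔ uniform
radius. [folklore] -/
theorem stringwise_iff_genFunCauchy (S : TorusScheme G O) (hβ : ∀ K, 0 ≤ S.β K)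
    (hm : ∀ K o, Measurable (S.obs K o)) (h1 : ∀ K o U, |S.obs K o U| ≤ 1) {l₀ : ℝ} (hl₀ : 0 < l₀) :
    StringwiseGenFunCauchy S ↔ T4Assembly.GenFunCauchy S l₀ :=
  (stringwise_iff_hasContinuumLimit S hβ hm h1).trans (T4GenFunConverse.hasContinuumLimit_iff_genFunCauchy S hβ hm h1 hl₀)

/-- Per-string hybrid-NE7 data ⇒ existence of the continuum limit along the full sequence, uniqueness of the limit points
label by label, and agreement of any two subsequential limit functionals. [folklore] -/
theorem hasContinuumLimit_of_stringwiseHybridNE7 (S : TorusScheme G O) (hβ : ∀ K, 0 ≤ S.β K)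
    (hm : ∀ K o, Measurable (S.obs K o)) (h1 : ∀ K o U, |S.obs K o U| ≤ 1) (h : StringwiseHybridNE7 S) :
    HasContinuumLimit S ∧ HasUniqueLimitPoints S ∧ LimitPointsAgree S := by
  have hL := hasContinuumLimit_of_stringwise S hβ hm h1 (stringwise_of_stringwiseHybridNE7 S hβ hm h1 h)
  exact ⟨hL, T4Assembly.hasUniqueLimitPoints_of_hasContinuumLimit S hL,
    limitPointsAgree_of_exists S ((hasContinuumLimit_iff_exists_isLimitFunctional S).mp hL)⟩

end Scheme

/-! ## §2 Under the targets' quantifier prefix -/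

section Prefix

variable {F : T4Family} {G : Type*} [GaugeGroup G] [MeasurableSpace G] [RegularGaugeGroup G] [HaarData G]

/-- Per-string Cauchy radii UNDER THE PREFIX (β-side hypothesis `Hβ`), along the data's Wilson schemes. [folklore] -/
def StringwiseUnder (D : FiniteEpsData F G) (Hβ : Prop) : Prop :=
  D.UnderHypotheses Hβ fun g₀ => StringwiseGenFunCauchy (D.scheme g₀)

/-- Per-string hybrid-NE7 data UNDER THE PREFIX (β-side hypothesis `Hβ`), along the data's Wilson schemes — node U5's
per-string output shape in place.  HYPOTHESIS SHAPE. [folklore] -/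
def HybridNE7Under (D : FiniteEpsData F G) (Hβ : Prop) : Prop :=
  D.UnderHypotheses Hβ fun g₀ => StringwiseHybridNE7 (D.scheme g₀)

omit [RegularGaugeGroup G] in
/-- `GenFunCauchyUnder ⇒ StringwiseUnder`. [folklore] -/
theorem stringwiseUnder_of_genFunCauchyUnder (D : FiniteEpsData F G) {Hβ : Prop}
    (h : T4Assembly.GenFunCauchyUnder D Hβ) : StringwiseUnder D Hβ :=
  FiniteEpsData.UnderHypotheses.mono (fun g₀ hg => by
    obtain ⟨l₀, hl₀, hU6⟩ := hg
    exact stringwise_of_genFunCauchy _ hl₀ hU6) h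

/-- `HybridNE7Under ⇒ StringwiseUnder`, for data with measurable averaging maps. [folklore] -/
theorem stringwiseUnder_of_hybridNE7Under (D : FiniteEpsData F G) (hM : D.AvgMeasurable) {Hβ : Prop}
    (h : HybridNE7Under D Hβ) : StringwiseUnder D Hβ :=
  FiniteEpsData.UnderHypotheses.mono (fun g₀ hg =>
    stringwise_of_stringwiseHybridNE7 (D.scheme g₀) (fun K => (D.scheme_β_eq g₀ K).2)
      (fun K C => D.measurable_avgObs hM K C) (fun K C U => D.abs_avgObs_le_one K C U) hg) h

omit [RegularGaugeGroup G] in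
/-- Anti-monotonicity in the β-side hypothesis. [folklore] -/
theorem HybridNE7Under.of_imp {D : FiniteEpsData F G} {H₁ H₂ : Prop} (himp : H₂ → H₁) (h : HybridNE7Under D H₁) :
    HybridNE7Under D H₂ :=
  FiniteEpsData.UnderHypotheses.of_imp himp h

/-- `StringwiseUnder D Hβ` ⇒ existence of a limit functional under the prefix. [folklore] -/
theorem underHypotheses_exists_of_stringwiseUnder (D : FiniteEpsData F G) (hM : D.AvgMeasurable) {Hβ : Prop}
    (h : StringwiseUnder D Hβ) :
    D.UnderHypotheses Hβ fun g₀ => ∃ E : List (ULoop F) → ℝ, IsLimitFunctional (D.scheme g₀).expectAt E :=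
  FiniteEpsData.UnderHypotheses.mono (fun g₀ hg =>
    (hasContinuumLimit_iff_exists_isLimitFunctional _).mp
      (hasContinuumLimit_of_stringwise (D.scheme g₀) (fun K => (D.scheme_β_eq g₀ K).2)
        (fun K C => D.measurable_avgObs hM K C) (fun K C U => D.abs_avgObs_le_one K C U) hg)) h

/-- **UNDER THE PREFIX, PER-STRING RADII ⇔ EXISTENCE**, for ANY β-side hypothesis. [folklore] -/
theorem underHypotheses_exists_iff_stringwiseUnder (D : FiniteEpsData F G) (hM : D.AvgMeasurable) (Hβ : Prop) :
    D.UnderHypotheses Hβ (fun g₀ => ∃ E : List (ULoop F) → ℝ, IsLimitFunctional (D.scheme g₀).expectAt E) ↔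
      StringwiseUnder D Hβ :=
  ⟨fun h => stringwiseUnder_of_genFunCauchyUnder D
      ((T4GenFunConverse.underHypotheses_exists_iff_genFunCauchyUnder D hM Hβ).mp h),
    underHypotheses_exists_of_stringwiseUnder D hM⟩

/-- **THE EXISTENCE TARGET ⇔ `StringwiseUnder`** (scoping note's β-side hypothesis `BetaPertHyp D.βfun`). [folklore] -/
theorem limit_exists_iff_stringwiseUnder (D : FiniteEpsData F G) (hM : D.AvgMeasurable) :
    D.ym4_torus_continuum_limit_exists ↔ StringwiseUnder D (BetaPertHyp D.βfun) :=
  underHypotheses_exists_iff_stringwiseUnder D hM _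

/-- Print-faithful form (`DagBinding.EndpointExistence D.C.toB12`). [folklore] -/
theorem limit_exists'_iff_stringwiseUnder' (D : FiniteEpsData F G) (hM : D.AvgMeasurable) :
    D.ym4_torus_continuum_limit_exists' ↔ StringwiseUnder D (DagBinding.EndpointExistence D.C.toB12) :=
  underHypotheses_exists_iff_stringwiseUnder D hM _

/-- **PER-STRING HYBRID-NE7 DATA UNDER THE PREFIX ⇒ THE EXISTENCE TARGET.** [folklore] -/
theorem limit_exists_of_hybridNE7Under (D : FiniteEpsData F G) (hM : D.AvgMeasurable)
    (h : HybridNE7Under D (BetaPertHyp D.βfun)) : D.ym4_torus_continuum_limit_exists :=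
  (limit_exists_iff_stringwiseUnder D hM).mpr (stringwiseUnder_of_hybridNE7Under D hM h)

/-- Print-faithful form. [folklore] -/
theorem limit_exists'_of_hybridNE7Under' (D : FiniteEpsData F G) (hM : D.AvgMeasurable)
    (h : HybridNE7Under D (DagBinding.EndpointExistence D.C.toB12)) : D.ym4_torus_continuum_limit_exists' :=
  (limit_exists'_iff_stringwiseUnder' D hM).mpr (stringwiseUnder_of_hybridNE7Under D hM h)

/-- … and then uniqueness of the limit (the tree's `limit_unique_of_limit_exists`). [folklore] -/
theorem limit_unique_of_hybridNE7Under (D : FiniteEpsData F G) (hM : D.AvgMeasurable)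
    (h : HybridNE7Under D (BetaPertHyp D.βfun)) : D.ym4_torus_continuum_limit_unique :=
  D.limit_unique_of_limit_exists (limit_exists_of_hybridNE7Under D hM h)

end Prefix

/-! ## §3 The apex: (0.4)-data on `SU(N)` -/

section SU

variable {F : T4Family} {N : ℕ} [NeZero N] {D : FiniteEpsData F (Matrix.specialUnitaryGroup (Fin N) ℂ)}
  {𝓜 : GroupAverage (Matrix.specialUnitaryGroup (Fin N) ℂ)} {ℰ : LoopAverage (Matrix.specialUnitaryGroup (Fin N) ℂ)}

/-- **THE APEX FED BY NODE U5's PER-STRING OUTPUT** (scoping note's form): for (0.4)-data on `SU(N)` with a measurable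
small-field average, per-string hybrid-NE7 data under the prefix ⇒ ALL FOUR TARGETS. [folklore] -/
theorem targets_of_hybridNE7Under (h : D.IsBlockAveraged ℰ) (hE : ℰ.MeasurableE)
    (hNE : HybridNE7Under D (BetaPertHyp D.βfun)) :
    D.ym4_torus_continuum_limit_exists ∧ D.ym4_torus_continuum_limit_unique ∧
      D.limit_reflectionPositive ∧ D.limit_torusCovariant :=
  h.targets_of_exists hE (limit_exists_of_hybridNE7Under D (h.avgMeasurable hE) hNE)

/-- Print-faithful form. [folklore] -/
theorem targets'_of_hybridNE7Under' (h : D.IsBlockAveraged ℰ) (hE : ℰ.MeasurableE)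
    (hNE : HybridNE7Under D (DagBinding.EndpointExistence D.C.toB12)) :
    D.ym4_torus_continuum_limit_exists' ∧ D.ym4_torus_continuum_limit_unique' ∧
      D.limit_reflectionPositive' ∧ D.limit_torusCovariant' :=
  h.targets'_of_exists' hE (limit_exists'_of_hybridNE7Under' D (h.avgMeasurable hE) hNE)

/-- Two-level (0.4)-data (`IsBlockAveraged₂`): the same. [folklore] -/
theorem targets₂_of_hybridNE7Under (h : D.IsBlockAveraged₂ 𝓜 ℰ) (hM : 𝓜.MeasurableM) (hE : ℰ.MeasurableE)
    (hNE : HybridNE7Under D (BetaPertHyp D.βfun)) :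
    D.ym4_torus_continuum_limit_exists ∧ D.ym4_torus_continuum_limit_unique ∧
      D.limit_reflectionPositive ∧ D.limit_torusCovariant :=
  h.targets_of_exists hM hE (limit_exists_of_hybridNE7Under D (h.avgMeasurable hM hE) hNE)

/-- Two-level, print-faithful form. [folklore] -/
theorem targets₂'_of_hybridNE7Under' (h : D.IsBlockAveraged₂ 𝓜 ℰ) (hM : 𝓜.MeasurableM) (hE : ℰ.MeasurableE)
    (hNE : HybridNE7Under D (DagBinding.EndpointExistence D.C.toB12)) :
    D.ym4_torus_continuum_limit_exists' ∧ D.ym4_torus_continuum_limit_unique' ∧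
      D.limit_reflectionPositive' ∧ D.limit_torusCovariant' :=
  h.targets'_of_exists' hM hE (limit_exists'_of_hybridNE7Under' D (h.avgMeasurable hM hE) hNE)

/-- **THE FOUR TARGETS ⇔ PER-STRING CAUCHY RADII UNDER THE PREFIX**, per (0.4)-datum. [folklore] -/
theorem targets_iff_stringwiseUnder (h : D.IsBlockAveraged ℰ) (hE : ℰ.MeasurableE) :
    (D.ym4_torus_continuum_limit_exists ∧ D.ym4_torus_continuum_limit_unique ∧
      D.limit_reflectionPositive ∧ D.limit_torusCovariant) ↔ StringwiseUnder D (BetaPertHyp D.βfun) :=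
  ⟨fun ht => (limit_exists_iff_stringwiseUnder D (h.avgMeasurable hE)).mp ht.1,
    fun hs => h.targets_of_exists hE ((limit_exists_iff_stringwiseUnder D (h.avgMeasurable hE)).mpr hs)⟩

/-- Print-faithful form. [folklore] -/
theorem targets'_iff_stringwiseUnder' (h : D.IsBlockAveraged ℰ) (hE : ℰ.MeasurableE) :
    (D.ym4_torus_continuum_limit_exists' ∧ D.ym4_torus_continuum_limit_unique' ∧
      D.limit_reflectionPositive' ∧ D.limit_torusCovariant') ↔ StringwiseUnder D (DagBinding.EndpointExistence D.C.toB12) :=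
  ⟨fun ht => (limit_exists'_iff_stringwiseUnder' D (h.avgMeasurable hE)).mp ht.1,
    fun hs => h.targets'_of_exists' hE ((limit_exists'_iff_stringwiseUnder' D (h.avgMeasurable hE)).mpr hs)⟩

end SU

/-- **THE RESTRICTED `SU(N)` HEADLINE FROM PER-STRING HYBRID-NE7 DATA FOR ALL (0.4)-DATA** (scoping note's form): if
for every lattice family, every measurable small-field average and every (0.4)-datum node U5's per-string output holds
under the prefix, then `T4Apex.YM4TorusContinuumBlockSU N`.  CONDITIONAL; the antecedent is the cell's located new
estimates, none in print. [folklore] -/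
theorem blockSU_of_hybridNE7Under {N : ℕ} [NeZero N]
    (h : ∀ (F : T4Family) (ℰ : LoopAverage (Matrix.specialUnitaryGroup (Fin N) ℂ)), ℰ.MeasurableE →
      ∀ D : FiniteEpsData F (Matrix.specialUnitaryGroup (Fin N) ℂ), D.IsBlockAveraged ℰ →
        HybridNE7Under D (BetaPertHyp D.βfun)) :
    T4Apex.YM4TorusContinuumBlockSU N :=
  fun F ℰ hE D hD => targets_of_hybridNE7Under hD hE (h F ℰ hE D hD)

/-- Print-faithful form. [folklore] -/
theorem blockSU'_of_hybridNE7Under' {N : ℕ} [NeZero N]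
    (h : ∀ (F : T4Family) (ℰ : LoopAverage (Matrix.specialUnitaryGroup (Fin N) ℂ)), ℰ.MeasurableE →
      ∀ D : FiniteEpsData F (Matrix.specialUnitaryGroup (Fin N) ℂ), D.IsBlockAveraged ℰ →
        HybridNE7Under D (DagBinding.EndpointExistence D.C.toB12)) :
    T4Apex.YM4TorusContinuumBlockSU' N :=
  fun F ℰ hE D hD => targets'_of_hybridNE7Under' hD hE (h F ℰ hE D hD)

/-- **… AND THE HEADLINE ⇔ PER-STRING CAUCHY RADII FOR ALL (0.4)-DATA.** [folklore] -/
theorem blockSU_iff_stringwiseUnder {N : ℕ} [NeZero N] :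
    T4Apex.YM4TorusContinuumBlockSU N ↔
      ∀ (F : T4Family) (ℰ : LoopAverage (Matrix.specialUnitaryGroup (Fin N) ℂ)), ℰ.MeasurableE →
        ∀ D : FiniteEpsData F (Matrix.specialUnitaryGroup (Fin N) ℂ), D.IsBlockAveraged ℰ →
          StringwiseUnder D (BetaPertHyp D.βfun) :=
  ⟨fun hS F ℰ hE D hD => (targets_iff_stringwiseUnder hD hE).mp (hS F ℰ hE D hD),
    fun h F ℰ hE D hD => (targets_iff_stringwiseUnder hD hE).mpr (h F ℰ hE D hD)⟩

end T4ApexHybrid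

end Literature.MathematicalPhysics.QuantumFieldTheory.Balaban1983to89
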